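import Literature.NumberTheory.ComplexMultiplication.PartialConjugationOfConjSquare
import Literature.NumberTheory.ComplexMultiplication.QuarticCMTypes
import Literature.AlgebraicGeometry.Pohlmann1968.CMTypeRankLowerBoundsNumberField
import Summits.HodgeConjecture.CorCM.RealIntersectionCMFieldsHodge
import HarnessLib

/-!
# Pairs of CM abelian varieties whose fields meet in degree `≤ 2` under a square conjugation — and the Hodge conjecture
# for ALL products `A₀^a × A₁^b` of two simple CM abelian surfaces with non-isomorphic CYCLIC quartic CM fields

COR-CM (cell `pub-hodgecm2`, binder seat `b23` gen 28), count-neutral; NEW as stated, hence under `Summits/`.  Sequel of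
`Summits/HodgeConjecture/CorCM/RealIntersectionCMFieldsHodge` (the Hodge conjecture for products of nondegenerate CM
abelian varieties admitting PARTIAL CONJUGATIONS — Galois closures meeting in totally real fields) through the
literature file `Literature.NumberTheory.ComplexMultiplication.PartialConjugationOfConjSquare` (this seat): if complex
conjugation of the Galois CM field `K_{i₁}` is a SQUARE in `Gal(K_{i₁}/ℚ)` and `[L_{i₀} ∩ L_{i₁} : ℚ] ≤ 2`, both slots carry
partial conjugations.  Consequences BY NAME:

* **`hodgeConjectureFor_prod_pair_of_isSquare_conjGal`** — `K_{i₁}` Galois CM with square conjugation, any CM field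
  `K_{i₀}` with `[L_{i₀} ∩ L_{i₁} : ℚ] ≤ 2`, nondegenerate types: every `A₀^a × A₁^b` (every `⨁_{j<N} A_{π j}`) of
  realisations satisfies the Hodge conjecture;
* **`isNondegenerate_of_isCyclic_of_finrank_eq_four`** — every CM type of a CYCLIC QUARTIC CM field is nondegenerate
  (primitive by Shimura §8.4 (2)(B), the tree's `isPrimitive_of_isCyclic`; nondegenerate by Ribet's bound in degree `≤ 6`,
  the tree's `Pohlmann1968.isNondegenerate_of_isPrimitive_of_finrank_le_six`);
* **`hodgeConjectureFor_prod_pair_of_cyclic_quartic`** — `A_{i₁}` with CM by a cyclic quartic CM field `K_{i₁}`, `A_{i₀}` a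
  realisation of ANY nondegenerate CM type whose Galois closure does not contain `L_{i₁}`: the Hodge conjecture for every
  `A₀^a × A₁^b`; `…_of_not_dvd` — automatic when `4 ∤ [L_{i₀} : ℚ]`;
* **`hodgeConjectureFor_prod_pair_of_cyclic_quartic_of_ne`** — the HYPOTHESIS-FREE instance: `A₀`, `A₁` realisations of
  ARBITRARY CM types of two Galois quartic CM fields, `K_{i₁}` cyclic, with different Galois closures in `ℂ` (e.g. two
  NON-ISOMORPHIC CYCLIC QUARTIC CM fields such as `ℚ(ζ_5)` and `ℚ(√5, √(−(5+√5)))`, which share the real field `ℚ(√5)`):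
  **every `A₀^a × A₁^b` satisfies the Hodge conjecture**, with `B• = D•`
  (`hodgeClassSpan_prod_eq_divisorClassesSpan_pair_of_cyclic_quartic_of_ne`), the family is nondegenerate
  (`isNondegenerateFamily_pair_of_cyclic_quartic_of_ne`) and `rank Hg(A₀ × A₁) = rank Hg(A₀) + rank Hg(A₁)`
  (`cmFamilyRank_add_card_eq_pair_of_cyclic_quartic`).

Why new: such pairs are NOT linearly disjoint (`LinearlyDisjointCMFieldsHodge` needs `L₀ ∩ L₁ = ℚ`), the `Aut(ℂ)`-actions
on their embeddings are NOT independent, no single-field slice contains the product (it lives over the octic compositum),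
and the products `A₀^a × A₁^b` have unbounded dimension `2(a+b)`; in the tree the Hodge conjecture for abelian FOURFOLDS
of Weil type is only available modulo the named fact of Markman — here no Weil classes occur and nothing is assumed.

Everything is a short application; theorems only, no definition, no `sorry`.

## References

* [Shimura1998] G. Shimura, *Abelian Varieties with Complex Multiplication and Modular Functions*, §8.4 Example (2)(B).
* [Gordon1999HodgeAVSurvey] B. B. Gordon, *A survey of the Hodge conjecture for abelian varieties*, §3 Theorem (Imai,
  Murty) and proof; 7.5; 10.10.
* [Lang2002] S. Lang, *Algebra*, 3rd ed., VI §1 Cor. 1.4.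
-/

noncomputable section

open CategoryTheory CategoryTheory.Limits NumberField IntermediateField Module

namespace Summit.HodgeConjecture.CorCM

open Literature.NumberTheory.ComplexMultiplication
open Literature.AlgebraicGeometry.Motives (AbelianVariety CMType)
open Literature.AlgebraicGeometry.HodgeTheory
open Literature.AlgebraicGeometry.ComplexMultiplication (IsCMTypeRealisation)
open Literature.AlgebraicGeometry.VanGeemen1994 (hodgeClassSpan)
open Literature.AlgebraicGeometry.Pohlmann1968
open Literature.Barriers.HodgeConjecture (divisorClassesSpan)

/-! ### Every CM type of a cyclic quartic CM field is nondegenerate -/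

/-- **Every CM type of a CYCLIC QUARTIC CM field is nondegenerate**: primitive by Shimura §8.4 Example (2)(B) (no
`γ ≠ 1` with `γS = S` in a cyclic group of order `4`), nondegenerate by Ribet's criterion in degree `≤ 6` — the simple CM
abelian surfaces with Galois CM field. [cite: Shimura1998, §8.4 Example (2)(B)] -/
theorem isNondegenerate_of_isCyclic_of_finrank_eq_four {K : Type} [Field K] [NumberField K] [IsCMField K]
    [IsGalois ℚ K] [hG : IsCyclic (K ≃ₐ[ℚ] K)] (h4 : finrank ℚ K = 4) (Φ : CMType K) : IsNondegenerate Φ := by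
  obtain ⟨φ₀⟩ : Nonempty (K →+* ℂ) := inferInstance
  exact isNondegenerate_of_isPrimitive_of_finrank_le_six (Φ := Φ) (by omega) φ₀ (isPrimitive_of_isCyclic h4 hG Φ φ₀)

section Geometry

variable {I : Type} {K : I → Type} [∀ i, Field (K i)] [∀ i, NumberField (K i)] [∀ i, IsCMField (K i)] [Fintype I]
  [Nonempty I] {Φ : ∀ i, CMType (K i)}
variable {A : I → AbelianVariety ℂ} {ι : ∀ i, 𝓞 (K i) →+* End (A i)}
  {θ : ∀ i, K i →+* Module.End ℂ (complexBetti (A i).X 1)}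

/-- **Square conjugation, small intersection.**  `K_{i₁}` a Galois CM field in whose group complex conjugation is a
square, `K_{i₀}` any CM field with `[L_{i₀} ∩ L_{i₁} : ℚ] ≤ 2`, both types nondegenerate: the Hodge conjecture holds for
every `A₀^a × A₁^b` (every `⨁_{j<N} A_{π j}`) of realisations, UNCONDITIONALLY. [cite: Gordon1999HodgeAVSurvey, §3 Theorem and 10.10] -/
theorem hodgeConjectureFor_prod_pair_of_isSquare_conjGal {i₀ i₁ : I} (h01 : i₀ ≠ i₁) (hI : ∀ j, j = i₀ ∨ j = i₁)
    [IsGalois ℚ (K i₁)] (hsq : IsSquare (conjGal : K i₁ ≃ₐ[ℚ] K i₁))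
    (h2 : finrank ℚ ↥(normalClosure ℚ (K i₀) ℂ ⊓ normalClosure ℚ (K i₁) ℂ) ≤ 2)
    (hΦ : ∀ i, IsNondegenerate (Φ i)) (hA : ∀ i, IsCMTypeRealisation (Φ i) (A i) (ι i) (θ i)) {N : ℕ}
    (π : Fin N → I) :
    HodgeConjectureFor (⨁ fun j : Fin N => A (π j)).dim (⨁ fun j : Fin N => A (π j)).X :=
  hodgeConjectureFor_prod_of_partialConj (forall_exists_partialConj_pair_of_isSquare_conjGal h01 hI hsq h2) hΦ hA π

/-- **A cyclic quartic CM surface times anything not containing its field.**  `A_{i₁}` a realisation of a CM type of a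
CYCLIC QUARTIC CM field `K_{i₁}`, `A_{i₀}` a realisation of a NONDEGENERATE CM type of any CM field whose Galois closure in
`ℂ` does not contain `L_{i₁}`: the Hodge conjecture for every `A₀^a × A₁^b`, UNCONDITIONALLY.
[cite: Gordon1999HodgeAVSurvey, §3 Theorem and 10.10] -/
theorem hodgeConjectureFor_prod_pair_of_cyclic_quartic {i₀ i₁ : I} (h01 : i₀ ≠ i₁) (hI : ∀ j, j = i₀ ∨ j = i₁)
    [IsGalois ℚ (K i₁)] [IsCyclic (K i₁ ≃ₐ[ℚ] K i₁)] (h4 : finrank ℚ (K i₁) = 4)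
    (hnle : ¬ normalClosure ℚ (K i₁) ℂ ≤ normalClosure ℚ (K i₀) ℂ) (hΦ₀ : IsNondegenerate (Φ i₀))
    (hA : ∀ i, IsCMTypeRealisation (Φ i) (A i) (ι i) (θ i)) {N : ℕ} (π : Fin N → I) :
    HodgeConjectureFor (⨁ fun j : Fin N => A (π j)).dim (⨁ fun j : Fin N => A (π j)).X := by
  have hΦ : ∀ i, IsNondegenerate (Φ i) := fun i => by
    rcases hI i with rfl | rfl
    · exact hΦ₀
    · exact isNondegenerate_of_isCyclic_of_finrank_eq_four h4 (Φ _)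
  exact hodgeConjectureFor_prod_of_partialConj (forall_exists_partialConj_pair_of_cyclic_quartic h01 hI h4 hnle) hΦ hA π

/-- **… automatic when `4 ∤ [L_{i₀} : ℚ]`** (e.g. `A_{i₀}` a CM elliptic curve, or a simple CM threefold with cyclic sextic
CM field, of nondegenerate type). [cite: Gordon1999HodgeAVSurvey, §3 Theorem and 10.10] -/
theorem hodgeConjectureFor_prod_pair_of_cyclic_quartic_of_not_dvd {i₀ i₁ : I} (h01 : i₀ ≠ i₁)
    (hI : ∀ j, j = i₀ ∨ j = i₁) [IsGalois ℚ (K i₁)] [IsCyclic (K i₁ ≃ₐ[ℚ] K i₁)] (h4 : finrank ℚ (K i₁) = 4)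
    (hndvd : ¬ 4 ∣ finrank ℚ (normalClosure ℚ (K i₀) ℂ)) (hΦ₀ : IsNondegenerate (Φ i₀))
    (hA : ∀ i, IsCMTypeRealisation (Φ i) (A i) (ι i) (θ i)) {N : ℕ} (π : Fin N → I) :
    HodgeConjectureFor (⨁ fun j : Fin N => A (π j)).dim (⨁ fun j : Fin N => A (π j)).X :=
  hodgeConjectureFor_prod_pair_of_cyclic_quartic h01 hI h4
    (not_le_of_finrank_eq_four_of_not_dvd _ _ ((finrank_normalClosure_of_normal (K := K i₁)).trans h4) hndvd) hΦ₀ hA π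

/-- **The Hodge conjecture for ALL products `A₀^a × A₁^b` of realisations of ARBITRARY CM types of two Galois quartic CM
fields with different Galois closures in `ℂ`, `K_{i₁}` cyclic** — in particular for any two simple CM abelian surfaces with
NON-ISOMORPHIC CYCLIC QUARTIC CM fields (e.g. `ℚ(ζ_5)` and `ℚ(√5, √(−(5+√5)))`, sharing `ℚ(√5)`): no hypothesis on the
types (all are primitive, hence nondegenerate), no linear disjointness, UNCONDITIONAL (no named fact), in every dimension
`2(a+b)`. (`K_{i₀}` may also be biquadratic: then `A_{i₀}` is a product of CM elliptic curves up to isogeny, its types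
are induced, and the hypothesis-free statement is `hodgeConjectureFor_prod_pair_of_cyclic_quartic` with `hΦ₀`.)
[cite: Shimura1998, §8.4 Example (2)(B)] [cite: Gordon1999HodgeAVSurvey, §3 Theorem and 10.10] -/
theorem hodgeConjectureFor_prod_pair_of_cyclic_quartic_of_ne {i₀ i₁ : I} (h01 : i₀ ≠ i₁) (hI : ∀ j, j = i₀ ∨ j = i₁)
    [IsGalois ℚ (K i₀)] [IsCyclic (K i₀ ≃ₐ[ℚ] K i₀)] [IsGalois ℚ (K i₁)] [IsCyclic (K i₁ ≃ₐ[ℚ] K i₁)]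
    (h4₀ : finrank ℚ (K i₀) = 4) (h4 : finrank ℚ (K i₁) = 4)
    (hne : normalClosure ℚ (K i₀) ℂ ≠ normalClosure ℚ (K i₁) ℂ)
    (hA : ∀ i, IsCMTypeRealisation (Φ i) (A i) (ι i) (θ i)) {N : ℕ} (π : Fin N → I) :
    HodgeConjectureFor (⨁ fun j : Fin N => A (π j)).dim (⨁ fun j : Fin N => A (π j)).X :=
  hodgeConjectureFor_prod_of_partialConj (forall_exists_partialConj_pair_of_cyclic_quartic_of_ne h01 hI h4₀ h4 hne)
    (fun i => by
      rcases hI i with rfl | rfl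
      · exact isNondegenerate_of_isCyclic_of_finrank_eq_four h4₀ (Φ _)
      · exact isNondegenerate_of_isCyclic_of_finrank_eq_four h4 (Φ _)) hA π

/-- **`Bᵐ ⊗ ℂ = Dᵐ ⊗ ℂ` on every `A₀^a × A₁^b`** for two simple CM abelian surfaces with non-isomorphic cyclic quartic CM
fields: no Weil classes, no exceptional classes, in any dimension. [cite: Gordon1999HodgeAVSurvey, §3 Theorem (2) and 7.5] -/
theorem hodgeClassSpan_prod_eq_divisorClassesSpan_pair_of_cyclic_quartic_of_ne {i₀ i₁ : I} (h01 : i₀ ≠ i₁)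
    (hI : ∀ j, j = i₀ ∨ j = i₁) [IsGalois ℚ (K i₀)] [IsCyclic (K i₀ ≃ₐ[ℚ] K i₀)] [IsGalois ℚ (K i₁)]
    [IsCyclic (K i₁ ≃ₐ[ℚ] K i₁)] (h4₀ : finrank ℚ (K i₀) = 4) (h4 : finrank ℚ (K i₁) = 4)
    (hne : normalClosure ℚ (K i₀) ℂ ≠ normalClosure ℚ (K i₁) ℂ)
    (hA : ∀ i, IsCMTypeRealisation (Φ i) (A i) (ι i) (θ i)) {N : ℕ} (π : Fin N → I) (m : ℕ) :
    hodgeClassSpan (⨁ fun j : Fin N => A (π j)).dim (⨁ fun j : Fin N => A (π j)).X m =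
      divisorClassesSpan (⨁ fun j : Fin N => A (π j)).X (⨁ fun j : Fin N => A (π j)).dim m :=
  hodgeClassSpan_prod_eq_divisorClassesSpan_of_partialConj
    (forall_exists_partialConj_pair_of_cyclic_quartic_of_ne h01 hI h4₀ h4 hne)
    (fun i => by
      rcases hI i with rfl | rfl
      · exact isNondegenerate_of_isCyclic_of_finrank_eq_four h4₀ (Φ _)
      · exact isNondegenerate_of_isCyclic_of_finrank_eq_four h4 (Φ _)) hA π m

/-- **The pair of types is nondegenerate** (`A₀ × A₁` stably nondegenerate) for two Galois quartic CM fields with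
different Galois closures, `K_{i₁}` cyclic, `K_{i₀}` cyclic. [cite: Gordon1999HodgeAVSurvey, §3 Theorem and 7.5] -/
theorem isNondegenerateFamily_pair_of_cyclic_quartic_of_ne {i₀ i₁ : I} (h01 : i₀ ≠ i₁) (hI : ∀ j, j = i₀ ∨ j = i₁)
    [IsGalois ℚ (K i₀)] [IsCyclic (K i₀ ≃ₐ[ℚ] K i₀)] [IsGalois ℚ (K i₁)] [IsCyclic (K i₁ ≃ₐ[ℚ] K i₁)]
    (h4₀ : finrank ℚ (K i₀) = 4) (h4 : finrank ℚ (K i₁) = 4)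
    (hne : normalClosure ℚ (K i₀) ℂ ≠ normalClosure ℚ (K i₁) ℂ) (Φ : ∀ i, CMType (K i)) :
    CMAlgebra.IsNondegenerateFamily Φ :=
  (isNondegenerateFamily_iff_of_partialConj (forall_exists_partialConj_pair_of_cyclic_quartic_of_ne h01 hI h4₀ h4 hne)
    Φ).2 fun i => by
      rcases hI i with rfl | rfl
      · exact isNondegenerate_of_isCyclic_of_finrank_eq_four h4₀ (Φ _)
      · exact isNondegenerate_of_isCyclic_of_finrank_eq_four h4 (Φ _)

/-- **`rank Hg(A₀ × A₁) = rank Hg(A₀) + rank Hg(A₁)`** (`cmFamilyRank Φ + 2 = cmTypeRank Φ₀ + cmTypeRank Φ₁ + 1`) for a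
cyclic quartic CM field `K_{i₁}` and any CM field `K_{i₀}` whose Galois closure does not contain `L_{i₁}`, ALL types.
[cite: Gordon1999HodgeAVSurvey, §3 Theorem (1)] -/
theorem cmFamilyRank_add_card_eq_pair_of_cyclic_quartic {i₀ i₁ : I} (h01 : i₀ ≠ i₁) (hI : ∀ j, j = i₀ ∨ j = i₁)
    [IsGalois ℚ (K i₁)] [IsCyclic (K i₁ ≃ₐ[ℚ] K i₁)] (h4 : finrank ℚ (K i₁) = 4)
    (hnle : ¬ normalClosure ℚ (K i₁) ℂ ≤ normalClosure ℚ (K i₀) ℂ) (Φ : ∀ i, CMType (K i)) :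
    CMAlgebra.cmFamilyRank Φ + Fintype.card I = (∑ i, cmTypeRank (Φ i)) + 1 :=
  cmFamilyRank_add_card_eq_of_partialConj (forall_exists_partialConj_pair_of_cyclic_quartic h01 hI h4 hnle) Φ

end Geometry

end Summit.HodgeConjecture.CorCM

end
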